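import Mathlib
import HarnessLib
import HarnessLib.Audit
import Summits.Parity.Statement
import Literature.NumberTheory.Sieve.SingularSeries
import Literature.NumberTheory.Sieve.LevelOfDistribution

/-!
Route: PoissonVarianceAtom

CLOSED (retired) 2026-08-15T13:55:56Z by operator:999:2305528 — reason: not-a-thesis: assembly does not conclude the sub-problem Statement — note: D-0027 §2.1 audit (human 2026-08-15: routes that do not decide the summit are removed): the assembly concludes `PairsHL`, not the sub-problem statement; a NEW conforming route may be opened from the same idea (generated `closes : … → _root_.GeneralizedHardyLittlewood`).. The file is kept as the record of this route; refuted decls are indexed as negative knowledge (`ledger negatives`).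

# Route PoissonVarianceAtom — Cauchy–Schwarz in the modulus — Möbius-free fixed-residue prime
variance to co-level (log x)^3 plus the polylog Möbius atom give Hardy–Littlewood pairs, EH-free

Card poisson-variance-polylog-atom (spine), with the audit-r14 corrections (co-level (log x)^3, not
(log x)^{5+ε}; Λ-weighted atom).
Open ONE von Mangoldt factor, Λ(n) = Σ_{dm=n} μ(d) log m, so that exactly S_h(x) := Σ_{n≤x}
Λ(n)Λ(n+h) = Σ_{m≤x} log m Σ_{d≤x/m} μ(d)Λ(dm+h);
for m > M := ⌊(log x)^3⌋ the inner sums are von Mangoldt sums over the single progression h (mod d),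
d ≤ x/M, whose main terms give 𝔖({0,h})x + o(x)
by two convergent Möbius series (no level of distribution is needed for the main term) and whose
fluctuations are killed: for d ≤ √x/(log x)^B by
Bombieri–Vinogradov (PROVED in tree), and for every larger dyadic block by CAUCHY–SCHWARZ ACROSS THE
MODULI, |Σ_{d∼D} μ(d)·Fluct_d| ≤ 3 log(3x/D)·√D·√V(D),
which discards the Möbius signs and lands on a MÖBIUS-FREE mean square V(D) = Σ_{d∼D}
max_{t≤x}(ψ(t;d,h) − t/φ(d))² of primes in ONE residue class.
It suffices to show X = X₁ ∧ X₂ ∧ X₃ (each for every h ≥ 1): X₁ (FixedResidueVarianceLog) V(D) ≤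
x²/(D(log x)^A) for √x/(log x)^B ≤ D ≤ x^{1−ε}
(a log-power saving, 'Barban–Davenport–Halberstam for one residue'); X₂ (PoissonVarianceTop) V(D) ≤
x(log x)² for x^{1−ε} ≤ D ≤ x/(log x)^3 (Poisson size
x log x with one log of slack); X₃ (PolylogAtom) Σ_{m≤(log x)^3} log m |Σ_{d≤x/m} μ(d)Λ(dm+h)| =
o(x) — Möbius on shifted primes dilated by POLYLOGARITHMIC m only.
Then S_h(x) = 𝔖({0,h})x + o(x) = PairsHL(h) (target shared with TauberianTwins, stmt-Parity-0867).
X₁ and X₂ contain no Möbius or Liouville function; all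
parity content sits in X₃. A second, power-co-level exit is filed as support: X₁ ∧
MobiusDilatedShiftedPrimesAvg (= stmt-Parity-0613 of route
MobiusShiftedPrimes, verbatim) → PairsHL, i.e. Elliott–Halberstam in that route is replaced by the
Möbius-free L² statement X₁.
Lean: `(∀ h : ℕ, 1 ≤ h → ∀ ε : ℝ, 0 < ε → ∀ A : ℝ, 0 < A → ∀ B : ℝ, 0 < B → ∀ᶠ x : ℝ in
Filter.atTop, ∀ t : ℕ → ℝ, (∀ d, t d ∈ Set.Icc 1 x) → ∀ D : ℝ, x ^ (1 / 2 : ℝ) / Real.log x ^ B ≤ D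
→ D ≤ x ^ (1 - ε) → ∑ d ∈ (Finset.Ioc ⌊D⌋₊ ⌊2 * D⌋₊).filter (fun d => Squarefree d ∧ Nat.Coprime d
h), (Literature.NumberTheory.Sieve.LevelOfDistribution.chebyshevPsiMod d (h : ZMod d) (t d) - t d /
Nat.totient d) ^ 2 ≤ x ^ 2 / (D * Real.log x ^ A)) ∧ (∀ h : ℕ, 1 ≤ h → ∃ ε : ℝ, 0 < ε ∧ ∀ᶠ x : ℝ in
Filter.atTop, ∀ t : ℕ → ℝ, (∀ d, t d ∈ Set.Icc 1 x) → ∀ D : ℝ, x ^ (1 - ε) ≤ D → D ≤ x / Real.log x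
^ 3 → ∑ d ∈ (Finset.Ioc ⌊D⌋₊ ⌊2 * D⌋₊).filter (fun d => Squarefree d ∧ Nat.Coprime d h),
(Literature.NumberTheory.Sieve.LevelOfDistribution.chebyshevPsiMod d (h : ZMod d) (t d) - t d /
Nat.totient d) ^ 2 ≤ x * Real.log x ^ 2) ∧ (∀ h : ℕ, 1 ≤ h → (fun x : ℝ => ∑ m ∈ Finset.Icc 1
⌊Real.log x ^ 3⌋₊, Real.log m * |∑ d ∈ Finset.Icc 1 ⌊x / m⌋₊, (ArithmeticFunction.moebius d : ℝ) *
ArithmeticFunction.vonMangoldt (d * m + h)|) =o[Filter.atTop] fun x : ℝ => x)`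

## Assembly
Bookkeeping only, given the items (sorry-free shape checked in Sketch.lean; x real, N = ⌊x⌋). Fix h
≥ 1; take ε from PoissonVarianceTop, B from
Bombieri–Vinogradov at saving (log x)^{−2} (Literature.NumberTheory.Sieve.bombieri_vinogradov,
PROVED via bombieri_vinogradov_of_siegelWalfisz siegel_walfisz_holds; its
choice-function form y : ℕ → ℝ is exactly the t_d of the cruxes), M = ⌊(log x)^3⌋. OpeningIdentity
splits S_h(x) into the atom m ≤ M (= o(x) by PolylogAtom) and
Σ_{d ≤ x/M} μ(d) F_d with F_d = Σ_{M<m≤x/d} log m Λ(dm+h), a von Mangoldt sum over the progression h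
(mod d) on (dM+h, x+h]. Moduli with (d,h) > 1 see only powers of
primes dividing (d,h): ≤ (x/M)·O_h(log²x) = O(x/log x). For (d,h) = 1 write F_d = Main_d + Fluct_d
with Main_d = (d/φ(d))[G(x/d) − G(M)]; MainTermEvaluation gives
Σ'_d μ(d) Main_d = 𝔖({0,h})x + o(x); partial summation gives |Fluct_d| ≤ 3
log(x/d)·max_{t≤x+h}|ψ(t;d,h) − t/φ(d)| (apply the cruxes at x' = x + h). Then: d ≤ √x/(log x)^B:
BV ⇒ Σ|Fluct_d| ≪ x(log x)^{−1}; each dyadic block D < d ≤ 2D above: Cauchy–Schwarz, |Σ_{d∼D}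
μ(d)Fluct_d| ≤ 3 log(3x/D)·(#{d∼D})^{1/2}·V(D)^{1/2}; with
FixedResidueVarianceLog (A = 5, ε/2) on √x/(log x)^B < D ≤ x^{1−ε}: ≤ 2 log x blocks × 3x(log
x)^{−3/2} = o(x); with PoissonVarianceTop on x^{1−ε} < D ≤ x/M: geometric in
√D, ≤ 3√(x log²x)·√(x/M)·(3.5 log(3M) + 5.7) ≤ (31 log log x + 28)·x·(log x)^{−1/2} = o(x). Hence
S_h(N) − 𝔖({0,h})N = o(N): PairsHL at h. Onward (not claimed): PairsHL → tuples
needs BV for prime tuples (itself HL-type: the one-sided opening is special to pairs) → DimOne needs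
shift-uniformity |h| ≤ LN where Siegel zeros enter
(Literature.Barriers.Parity.SiegelZeroPrimePairBarrier) → DicksonFibration.Assembly →
Summit.Parity.GeneralizedHardyLittlewood.

Rationale: WHY THIS LINE. Mechanism: one Cauchy–Schwarz inequality in the modulus separates binary
Hardy–Littlewood into a statement with NO Möbius function in it (a second moment of
primes in a fixed residue class to moduli beyond √x: the object of Hooley1977BDH7,
FriedlanderGoldston1996, Montgomery1971 ch. 17 / Hooley1975BDH1 on the
all-residue side, and of the fixed-residue dispersion technology BombieriFriedlanderIwaniecActa1986,
BombieriFriedlanderIwaniec1987, BombieriFriedlanderIwaniec1989,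
DrappeauFiorilli2020, Maynard2020LargeModuliI for first moments) and a statement with nothing BUT
the Möbius function in it (Möbius orthogonal to shifted primes in
progressions to polylogarithmic moduli: the folklore conjecture
Literature.NumberTheory.Sieve.MoebiusShiftedPrimesConjecture / MurtyVatwani2017 / Vatwani2016 ch. 7
/
Harman2007 §14.2, here dilated only by m ≤ (log x)^3). Imported areas: the probabilistic
(Cramér/Poisson, Montgomery–Hooley) model of primes in progressions
supplies the size x log x of the hypothesis; the large-sieve/dispersion world supplies the form (L²
over moduli); multiplicative number theory (Chowla–Elliott–Sarnak
circle, Lichtman2020) owns the atom. What prior routes do not do: MobiusShiftedPrimes needs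
Elliott–Halberstam (item 0614, Type-I beyond every known method) and an
atom dilated to x^ε; DeterminantMoebius puts its variance hypothesis on MÖBIUS pair sums over the
determinant variety; here every hypothesis below co-level
(log x)^3 is about primes alone and is weight-insertion-invariant in Polymath's sense, so the parity
bit is confined to the smallest residual a one-sided opening
can leave (no level-of-distribution hypothesis, even the Friedlander–Granville-false level x/(log
x)^B, removes the polylog dilations). Negatives index: empty.

RANKED CRUXES. #0 PairsHL (target) — Hardy–Littlewood pairs, Λ-form, fixed shift: for every h ≥ 1,
Σ_{n≤N} Λ(n)Λ(n+h) = 𝔖({0,h})·N + o(N). Identical signature to TauberianTwins.PairsHL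
(stmt-Parity-0867) and DeterminantMoebius.PairsHL — the endpoint of this route's Assembly; tuples
and shift-uniformity (GHL proper) are route DicksonFibration's business, not claimed. (why it might
fail: Binary Hardy–Littlewood for a fixed shift is twin-prime strength: open; parity blocks every
sieve-theoretic deduction even under GEH (PrimePairParity); minor arcs keep L²-mass
(CircleMethodBinaryBarrier).) [HardyLittlewood1923, GreenTao2010, Polymath8b2014,
Literature.Barriers.Parity.PrimePairParity, Literature.Barriers.Parity.CircleMethodBinaryBarrier]
#2 PoissonVarianceTop (crux) — (card Crux 1, top scales; co-level corrected to (log x)^3) For every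
h ≥ 1 there is ε > 0 such that for all large x, every choice of lengths t_d ∈ [1, x] and every
co-scale x^{1−ε} ≤ D ≤ x/(log x)^3: Σ_{D<d≤2D, d squarefree, (d,h)=1} (ψ(t_d; d, h) − t_d/φ(d))² ≤
x(log x)². The Poisson (Cramér / Montgomery–Hooley) size of this maximal fixed-residue variance is ≍
x log x at every scale (each class h mod d carries ≍ x/(φ(d) log x) primes; Doob's inequality
absorbs the max over t); one log of slack. Möbius-free: primes in ONE residue class to moduli within
(log x)^3 of x. In the Assembly it kills, by Cauchy–Schwarz, the blocks x^{1−ε} < d ≤ x/(log x)^3 at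
cost ≤ 31·log(3(log x)^3)·x·(log x)^{−1/2} = o(x). [difficulty: open-problem] (why it might fail: At
D=x/(log x)^A, V(D)−Poisson is HL in SIGNED AGGREGATE over the (log x)^{2A} Sophie-Germain pairs
(dk+h,dk'+h), k≠k'≤x/D, to relative error (log x)^{2−A}: no method averages HL over polylog families
(MRT2019 need H≥X^{8/33}); a fixed-residue mean-square Ω-theorem of Maier/FGHM type kills it.)
[Hooley1977BDH7, FriedlanderGoldston1996, FriedlanderGranvilleHildebrandMaier1991,
FriedlanderGranville1992, MatomakiRadziwillTao2019, Kawada1995, DrappeauFiorilli2020,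
Literature.Barriers.Parity.FriedlanderGranvilleUniformityBarrier]
#3 PolylogAtom (crux) — (card Crux 2, Λ-weighted as 0613 per audit) For every h ≥ 1: Σ_{m ≤ (log
x)^3} log m · |Σ_{d ≤ x/m} μ(d)Λ(dm+h)| = o(x) — the Möbius function of the cofactor d of n = dm
does not correlate with primality of dm + h, ℓ¹-averaged over POLYLOGARITHMIC dilations m with the
log m weight of the opening (m = 1 has weight 0). Trivial mass ≍ x(3 log log x)²/2, so the demand is
a uniform saving just beyond (log log x)² — the (log x)^3-dilated instance of the dilation family
whose x^ε-instance is MobiusShiftedPrimes' M_avg (stmt-Parity-0613) and whose m = O(1) core is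
Literature.NumberTheory.Sieve.MoebiusShiftedPrimesConjecture with Λ-weights. [difficulty:
open-problem] (why it might fail: It is the Möbius–shifted-primes conjecture (open for every single
pair m,h; Lichtman2020 only averages over shifts) dilated by ALL m ≤ (log x)^3 with a uniform (log
log x)^{2+δ} saving; MR/entropy cancellation uses small prime factors, absent at primes
(Maynard2019TwinPrime p.6); parity-sensitive.)
[Literature.NumberTheory.Sieve.MoebiusShiftedPrimesConjecture, Lichtman2020, LichtmanTeravainen2022,
MurtyVatwani2017, Vatwani2016, Harman2007, Maynard2019TwinPrime, Pintz2015,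
Literature.Barriers.Parity.PrimePairParity]
#4 FixedResidueVarianceLog (crux) — (card Crux 1, power scales) For every h ≥ 1 and ε, A, B > 0, all
large x, all lengths t_d ∈ [1, x] and all √x/(log x)^B ≤ D ≤ x^{1−ε}: Σ_{D<d≤2D, d squarefree,
(d,h)=1} (ψ(t_d; d, h) − t_d/φ(d))² ≤ x²/(D (log x)^A) — a log-power saving over the trivial x²(log
x)²/D in mean square over moduli for ONE residue class beyond √x: 'Barban–Davenport–Halberstam for a
fixed residue', the L²-shadow of Elliott–Halberstam (which implies it) with Poisson room
x^{ε}/polylog to spare. The Assembly uses A = 5 (≤ 2 log x dyadic blocks, each ≤ 3x(log x)^{1−A/2}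
after Cauchy–Schwarz) and B from Bombieri–Vinogradov at saving (log x)^{−2}. [difficulty:
open-problem] (why it might fail: The large sieve bounds only the sum over ALL residues; for one
class the off-diagonal is prime pairs over the 2-slope family (dk+h,dk'+h), k,k'≤x/D, of size
(x/D)²<x; dispersion (BFI, Maynard) gives first moments/factorable weights, not L²; at D≈√x(log
x)^{O(1)} even GRH is (log x)^4 short.) [BombieriFriedlanderIwaniecActa1986,
BombieriFriedlanderIwaniec1987, BombieriFriedlanderIwaniec1989, Maynard2020LargeModuliI,
Hooley1975BDH1, Montgomery1971, FriedlanderGoldston1996,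
Literature.Barriers.Parity.LargeSieveLevelHalf]
#9 MobiusDilatedShiftedPrimesAvg (support) — Shared verbatim with
MobiusShiftedPrimes.MobiusDilatedShiftedPrimesAvg (stmt-Parity-0613, a crux there): for every h ≥ 1
there is ε > 0 with Σ_{m≤x^ε} log m |Σ_{d≤x/m} μ(d)Λ(dm+h)| = o(x). Role in THIS route: the atom of
the power-co-level exit PowerColevelExit, where FixedResidueVarianceLog replaces Elliott–Halberstam;
filed as support so as not to re-key staffing of an item already ranked in its home route.
[difficulty: open-problem] [Harman2007, MurtyVatwani2017, Vatwani2016, Lichtman2020]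
#9 OpeningIdentity (support) — The exact one-sided opening (provable now from Mathlib's
ArithmeticFunction.moebius_mul_log_eq_vonMangoldt and the reindexing n = dm ↔ (m, d ≤ x/m)): for all
h, x ∈ ℕ, Σ_{n≤x} Λ(n)Λ(n+h) = Σ_{m≤x} log m · Σ_{d≤x/m} μ(d)Λ(dm+h). [difficulty: provable-now]
[Mathlib ArithmeticFunction.moebius_mul_log_eq_vonMangoldt, BombieriAsymptoticSieve1976]
#9 MainTermEvaluation (support) — Main term of the opened sum, uniformly in the dilation cut: for
every h ≥ 1 and η > 0, for all large x and all integers 1 ≤ M ≤ √x, |Σ_{d ≤ x/M, (d,h)=1}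
μ(d)(d/φ(d))·[(x/d)log(x/d) − x/d − (M log M − M)] − 𝔖({0,h})·x| ≤ ηx. Here (d/φ(d))[G(x/d) − G(M)],
G(u) = u log u − u, is the expected value (density 1/φ(d)) of Σ_{M<m≤x/d} log m Λ(dm+h). Proof
(provable, PNT-rate inputs): Σ'_{d≤y} μ(d)/φ(d) ≪ e^{−c√log y} (times log x → 0 for y ≥ √x),
−Σ'_{d≤y} μ(d) log d/φ(d) → 𝔖({0,h}) (Bombieri (1.13)–(1.14); for odd h both sides vanish), Σ'_{d≤y}
μ(d) d/φ(d) ≪ y e^{−c√log y} (so the G(M) part is ≪ x log x·e^{−c√(log x/2)}); Siegel–Walfisz for μ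
is in tree. [difficulty: M] [BombieriAsymptoticSieve1976,
Literature.NumberTheory.Sieve.singularSeries_pair,
Literature.NumberTheory.LFunctions.SiegelWalfiszMoebius_holds, IwaniecKowalski2004]
#9 PowerColevelExit (support) — The power-co-level exit = the EH-free form of route
MobiusShiftedPrimes: OpeningIdentity → MainTermEvaluation → FixedResidueVarianceLog →
MobiusDilatedShiftedPrimesAvg → PairsHL. Proof = the Assembly's bookkeeping with M = ⌊x^ε⌋, ε from
0613 (WLOG ε ≤ 1/2 since the ℓ¹ atom is monotone in ε): Bombieri–Vinogradov (tree:
Literature.NumberTheory.Sieve.bombieri_vinogradov, proved) for d ≤ √x/(log x)^B; Cauchy–Schwarz per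
dyadic block with FixedResidueVarianceLog (A = 5, ε/2) for √x/(log x)^B < d ≤ x^{1−ε}: total ≤
6x(log x)^{2−A/2} = o(x); moduli with (d,h) > 1 contribute ≤ (x/M)·O_h(log² x) = o(x); the atom
covers m ≤ x^ε. [difficulty: L] [MurtyVatwani2017, Vatwani2019, BombieriAsymptoticSieve1976,
Literature.NumberTheory.Sieve.bombieri_vinogradov]

TWO-LAYER PLAN. Foreseen glued splits (k ≤ 3, depth 1), none filed now. PoissonVarianceTop ⇐
SGExpansion → SingularSeriesAverage → SGAggregate → PoissonVarianceTop:
(i) the exact expansion V(D) − diagonal = Σ_{k≠k'≤x/D} Σ_{d∼D} Λ(dk+h)Λ(dk'+h) − expected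
(provable); (ii) the Gallagher/Montgomery–Soundararajan average of the
singular series 𝔖_{k,k'} over the 2-slope family with its −½log-type secondary term (provable);
(iii) the signed aggregate HL statement over the family (the crux
proper). FixedResidueVarianceLog ⇐ a window piece √x/(log x)^B < D ≤ x^{1/2+δ} (BFI-II /
Maynard2020LargeModuliI dispersion range, where ℓ¹ bounds with
(log x)^{−2+o(1)} savings exist and an ℓ² upgrade is the bet) → the bulk x^{1/2+δ} < D ≤ x^{1−ε}
(Hooley/Montgomery conjecture for one residue; HL on average over
polynomially large 2-slope families, Kawada1995/Balog-type circle method as the engine to test) →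
glue. PolylogAtom ⇐ m prime ≤ (log x)^3 → composite m → glue
(Kátai/Bourgain–Sarnak–Ziegler propagation μ(pm') = −μ(m') relates dilations; card
katai-propagation-shifted-primes).

KILL CRITERIA. Refutation of PoissonVarianceTop (a fixed-residue mean-square Ω-theorem V(x/(log
x)^A) ≫ x(log x)^{2+η} for some A ≥ 3, Maier-matrix style) closes the POLYLOG
programme: pivot the Assembly to the power exit (PowerColevelExit with 0613) by `route edit`, do not
close. Refutation of FixedResidueVarianceLog at some scale
D = x^θ, θ ∈ (1/2, 1) refutes the Montgomery–Hooley philosophy for one residue and closes the route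
`refuted:FixedResidueVarianceLog` (and wounds
DeterminantMoebius.CoreVariance and card signed-mobius-level-sqrt alike). Refutation of PolylogAtom
for some h refutes PairsHL-under-X₁∧X₂; since X₁, X₂ are
believed, treat as evidence against HL(h) itself: file loudly, close `refuted:PolylogAtom`. PairsHL
proved elsewhere (any route) moots the route; 0613 proved
makes PowerColevelExit the live chain and PolylogAtom moot.

NOT DECOMPOSED YET. The ghost-insensitivity computation (card S2: a Selberg-type reweighting 1 ∓
λ(n)λ(n+h) of the prime measure moves V(D) only within Poisson size, so X₁, X₂ are
weight-insertion-invariant and carry no parity) — a barrier-type fact whose natural home is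
Literature/Barriers/Parity/PrimePairParity, not an item. The
Sophie-Germain expansion of V(D) and the singular-series average (Two-layer plan (i),(ii)). The
BFI-II window lemma (level-half bookkeeping of the retired card
level-half-residual-bfi2) — not needed here because the variance cruxes start at √x/(log x)^B where
Cauchy–Schwarz costs only x^{3/4+o(1)}. Numerical constants
(31, 3.5) and the choice co-level 3 / slack 1 (any co-level C > 1 + δ with slack (log x)^δ works; C
= 3, δ = 1 chosen for integer exponents and robustness to
lower-order terms). k-tuples, shift-uniformity, Siegel-zero bookkeeping for |h| ≤ LN (other routes).

CHEAPEST FALSIFIER. (i) kit numerics (not run this session: hub is compute-free for planners' inline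
work and the decisive scales are asymptotic): V(D)/(x log x) for h = 2, x = 10^7…10^{10},
D = x/(log x)^A, A = 3…8, max over t included — Poisson predicts a bounded ratio (≈
Σ_{d∼D}1/φ(d)-constant ≈ 2–4); growth like (log x)^{1+η} at fixed A refutes
PoissonVarianceTop empirically. The retired card's data (x ≤ 5·10^6, files num/level_*.out of
level-half-residual-bfi2) show Σ_{d∼D}|E_w|/x ≤ 0.43 and μ-signed block
sums ≤ 0.004x for D ≥ x^{0.7}, consistent with Poisson variance + √#moduli cancellation. (ii)
Literature: Hooley1977BDH7 (paywalled, acq-02452) and FGHM 1991 Thm A3 /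
Cor 2.2 (audit r14 read pp. 31–32: need a = a±(x) growing) — any fixed-a mean-square Ω-statement at
Q = x/(log x)^A kills crux 2 at once. (iii) A refuter re-derives
the exponent bookkeeping of the Assembly paragraph (co-level 3 vs slack 1; the factor 3 log(x/d)
from partial summation).

NUMBERS. Poisson size of V(D): ≍ x log x·Σ_{d∼D, sqfree,(d,h)=1} d/(φ(d)D) (all D ≤ x); hypothesis
X₂ allows x(log x)²; trivial (Brun–Titchmarsh) size at D = x/(log x)^A:
≍ x(log x)^{A+2}/(A log log x)². All-residue BDH/Montgomery–Hooley: Σ_{q≤Q}Σ_a E² = Qx log Q + cQx +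
O(x^{1/2}Q^{3/2} + x²(log x)^{−A}) (Hooley1975BDH1; as printed in
Brüdern–Wooley 2011 (1), read). Fixed-residue first moment: (N/x)Σ_{q≤x/N}(ψ(x;q,1) − x/φ(q)) ≤
−(log N)/2 − C₀ + O(N^{−171/448+ε}) for N ≤ e^{δ√log x} (DrappeauFiorilli2020
Thm 1.1, read) — bias O(log log x) per modulus, squared ≪ Poisson. Friedlander–Granville III: ≥
Q^{1−1/log log Q} moduli q ∈ (Q,2Q] with |π(x;q,a) − π(x)/φ(q)| ≥
δ_N π(x)/φ(q) at x = q(log q)^N (tree: FriedlanderGranvilleUniformityBarrier) — contributes ≤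
δ²x(log x)^N·Q^{−1/log log Q} = o(x) to V: consistent. HL on average over
shifts needs H ≥ X^{8/33} (MatomakiRadziwillTao2019); here the family at D = x/(log x)^A has (log
x)^{2A} members. Co-level (log x)^3; atom trivial mass ≈ 4.5x(log log x)²;
CS loss over the Poisson blocks ≤ (31 log log x + 28)·x/(log x)^{1/2}. Items at open: 9 (1 target, 3
cruxes, 4 supports, 1 assembly).

DEFINITION REQUESTS. None. ψ(x;q,a) =
Literature.NumberTheory.Sieve.LevelOfDistribution.chebyshevPsiMod, 𝔖 =
Literature.NumberTheory.Sieve.singularSeries, μ, Λ from Mathlib; the maximal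
discrepancy is expressed junk-free by choice functions t : ℕ → ℝ exactly as in
Literature.NumberTheory.Sieve.bombieri_vinogradov. Bib keys added this session:
Hooley1975BDH1, Hooley1977BDH7, FriedlanderGranvilleHildebrandMaier1991,
BombieriFriedlanderIwaniec1987, BombieriFriedlanderIwaniec1989, Vatwani2019, Kawada1995,
FriedlanderGoldston1996, DrappeauFiorilli2020, Maynard2020LargeModuliI (commit 3204aa283413).
Literature want: Hooley1977BDH7 full text (acq-02452).

Novelty: Searches (2026-08-15): `lit search "Barban-Davenport-Halberstam fixed residue class variance primes
arithmetic progressions large moduli"` (local 1 + crossref 20: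
Maynard Memoirs I–III 2025, BFI I–III, Hooley XIX, Fiorilli IMRN 2014, Bauer 2022); `lit search
--source zbmath "Hooley Barban Davenport Halberstam theorem"` (35: Hooley
I–XIX reviews, Vaughan 2001/2003, FriedlanderGoldston1996, Liu 1993, Brüdern–Wooley 2011,
Kawada1995); zbMATH Vatwani2019 (review unavailable; paywalled acq-01255);
crossref "twin primes Möbius shifted primes mean square … Cauchy–Schwarz reduction" (19, nothing
joining the two); `lit search --hybrid` local books (Elliott 1997
Duality, Hooley 1976/87, Friedlander Cetraro notes, Cojocaru–Murty, Montgomery–Vaughan: the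
classical CS+BDH move needs the sum over residues); `lit galaxy search
"Barban-Davenport-Halberstam" --star all` (27: Brüdern–Wooley read pp. 1–2, de la Bretèche–Fiorilli
arXiv:1611.08312 read pp. 1–3 (all-residue moments),
DrappeauFiorilli2020 read pp. 1–2, Mastrostefano 2021, BFI-I); `lit frontier Parity --since 2021`
(30, none on fixed-residue variances or Möbius at shifted primes);
`lit bridges Parity --cross any` (30 generic); ledger negatives (0); all 8 route files of the sub
and the 46 open cards' titles; audit r14 of the card (Vatwani2016
ch. 7 pp. 153–156 read by the auditor; FGHM pp. 1–6, 31–32 read).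
Nearest prior art found: Hooley1977BDH7 (fixed-residue distribution of E(x;a,k) over moduli,
CONDITIONAL on a prime-pair hypothe  [refs: 1611.08312, FriedlanderGoldston1996, Kawada1995, Vatwani2019, DrappeauFiorilli2020, Vatwani2016, MurtyVatwani2017, Harman2007]

Barriers (technique_class: cs-in-modulus bdh-fixed-residue moebius-shifted-primes): - technique_class: cs-in-modulus bdh-fixed-residue moebius-shifted-primes
- Literature.Barriers.Parity.SelbergParityBarrier: X₁, X₂ are distribution statements about Λ in
progressions (Type-I-flavoured, L²) and by the barrier cannot give PairsHL alone — consistent: the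
Assembly needs X₃, a Möbius-randomness input of exactly the non-sieve kind; the route budgets
parity, it does not evade it.
- Literature.Barriers.Parity.PrimePairParity: the ghost reweighting 1 − λ(n)λ(n+h) leaves X₁, X₂
within their bounds (card S2, to be checked by a refuter) and flips X₃; so the deduction is not
weight-insertion-invariant only through X₃ = the species Polymath2014_liouvilleShiftAP isolates.
Consistent.
- Literature.Barriers.Parity.LargeSieveLevelHalf: it does not evade it; the bet is that an L²
statement for ONE residue beyond √x (X₁) is reachable by dispersion/Kloosterman inputs for the
specific 2-slope family (BFI-II, Maynard2020LargeModuliI give ℓ¹/first moments just above √x) and by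
HL-on-average technology over polynomial families further up; conceded open for all D >
x^{1/2+o(1)}.
- Literature.Barriers.Parity.EquidistributionLimitBarrier: X₂ lives at moduli x/(log x)^A where
pointwise/all-moduli equidistribution is FALSE (FriedlanderGranville1989_weak,
FriedlanderGranvilleUniformityBarrier); evaded because X₂ is an L² AVERAGE over d ∼ D with a full
log of slack: the catalogued bad moduli (Q^{1−1/log log Q} of them, relative error δ) contribute o(x
log x); an averaged fixed-a Ω-theorem

Novelty grade: new-combination — REVIEW (refuter rreview g2, 08-15). STRUCTURE: retired correctly (D-0027 §2.1): Assembly concludes PairsHL (fixed-shift binary HL, stmt-0867), not GeneralizedHardyLittlewood (Green–Tao Conj 1.2); the continuation PairsHL→tuples→DimOne→GHL is disclaimed and itself HL-strength ⇒ no conforming re-filin (refuter refuter-rreview-route-Schanuel-Exception-0816cb8f-g2-0, 2026-08-15T14:16:08Z; prior: MurtyVatwani2017, Hooley1977BDH7, FriedlanderGoldston1996, Vatwani2016)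

History (route lifecycle, newest last):
- 2026-08-15T13:50:16Z · CLOSED retired — not-a-thesis: assembly does not conclude the sub-problem Statement (operator:999:1257524)
- 2026-08-15T13:55:56Z · CLOSED retired — not-a-thesis: assembly does not conclude the sub-problem Statement (operator:999:2305528)

sub-problem: GeneralizedHardyLittlewood · status: closed(retired) · opened planner-plancard-Parity-GeneralizedHardyLittl-c3157826-0 2026-08-15T12:19:38Z · rev 0 · ledger route-Parity-PoissonVarianceAtom
GENERATED by the gate from the ledger (D-0016/17). Provers cite these decls: `theorem foo : Summit.Parity.GeneralizedHardyLittlewood.Theses.PoissonVarianceAtom.<Decl> := …` in Summits/Parity/GeneralizedHardyLittlewood/Theorems/<Name>.lean.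
-/

namespace Summit.Parity.GeneralizedHardyLittlewood.Theses.PoissonVarianceAtom

open scoped BigOperators Topology Manifold Classical MeasureTheory ProbabilityTheory Matrix InnerProductSpace ComplexConjugate ContinuousMap
open Filter Set Function TopologicalSpace MeasureTheory

attribute [summit_statement] _root_.GeneralizedHardyLittlewood

/-- item stmt-Parity-0867 · target · rank 0 · closed · moot by None · by planner
why it might fail: Binary Hardy–Littlewood for a fixed shift is twin-prime strength: open; parity blocks every sieve-theoretic deduction even under GEH (PrimePairParity); minor arcs keep L²-mass (CircleMethodBinaryBarrier).
sources: HardyLittlewood1923, GreenTao2010, Polymath8b2014, Literature.Barriers.Parity.PrimePairParity, Literature.Barriers.Parity.CircleMethodBinaryBarrier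
[target] Hardy–Littlewood pairs, Λ-form, fixed shift: for every h ≥ 1, ∑_{n ≤ N} Λ(n)Λ(n+h) =
𝔖({0,h}) N + o(N). The d = 1, t = 2, fixed-shift content of GHL (uniformity in h ≤ L N is NOT
claimed here; see route DicksonFibration). Open. [HardyLittlewood1923] [GreenTao2010, Example 1] -/
@[route_item "route-Parity-PoissonVarianceAtom"]
def PairsHL : Prop :=
  ∀ h : ℕ, 1 ≤ h → (fun N : ℕ => ∑ n ∈ Finset.Icc 1 N, ArithmeticFunction.vonMangoldt n * ArithmeticFunction.vonMangoldt (n + h) - Literature.NumberTheory.Sieve.singularSeries ({0, (h : ℤ)} : Finset ℤ) * N) =o[Filter.atTop] fun N : ℕ => (N : ℝ)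

/-- item stmt-Parity-7901 · crux · rank 2 · closed · moot by None · by planner
why it might fail: At D=x/(log x)^A, V(D)−Poisson is HL in SIGNED AGGREGATE over the (log x)^{2A} Sophie-Germain pairs (dk+h,dk'+h), k≠k'≤x/D, to relative error (log x)^{2−A}: no method averages HL over polylog families (MRT2019 need H≥X^{8/33}); a fixed-residue mean-square Ω-theorem of Maier/FGHM type kills it.
sources: Hooley1977BDH7, FriedlanderGoldston1996, FriedlanderGranvilleHildebrandMaier1991, FriedlanderGranville1992, MatomakiRadziwillTao2019, Kawada1995
[crux] (card Crux 1, top scales; co-level corrected to (log x)^3) For every h ≥ 1 there is ε > 0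
such that for all large x, every choice of lengths t_d ∈ [1, x] and every co-scale x^{1−ε} ≤ D ≤
x/(log x)^3: Σ_{D<d≤2D, d squarefree, (d,h)=1} (ψ(t_d; d, h) − t_d/φ(d))² ≤ x(log x)². The Poisson
(Cramér / Montgomery–Hooley) size of this maximal fixed-residue variance is ≍ x log x at every scale
(each class h mod d carries ≍ x/(φ(d) log x) primes; Doob's inequality absorbs the max over t); one
log of slack. Möbius-free: primes in ONE residue class to moduli within (log x)^3 of x. In the
Assembly it kills, by Cauchy–Schwarz, the blocks x^{1−ε} < d ≤ x/(log x)^3 at cost ≤ 31·log(3(log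
x)^3)·x·(log x)^{−1/2} = o(x). [difficulty: open-problem] -/
@[route_item "route-Parity-PoissonVarianceAtom"]
def PoissonVarianceTop : Prop :=
  ∀ h : ℕ, 1 ≤ h → ∃ ε : ℝ, 0 < ε ∧ ∀ᶠ x : ℝ in Filter.atTop, ∀ t : ℕ → ℝ, (∀ d, t d ∈ Set.Icc 1 x) → ∀ D : ℝ, x ^ (1 - ε) ≤ D → D ≤ x / Real.log x ^ 3 → ∑ d ∈ (Finset.Ioc ⌊D⌋₊ ⌊2 * D⌋₊).filter (fun d => Squarefree d ∧ Nat.Coprime d h), (Literature.NumberTheory.Sieve.LevelOfDistribution.chebyshevPsiMod d (h : ZMod d) (t d) - t d / Nat.totient d) ^ 2 ≤ x * Real.log x ^ 2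

/-- item stmt-Parity-7902 · crux · rank 3 · closed · moot by None · by planner
why it might fail: It is the Möbius–shifted-primes conjecture (open for every single pair m,h; Lichtman2020 only averages over shifts) dilated by ALL m ≤ (log x)^3 with a uniform (log log x)^{2+δ} saving; MR/entropy cancellation uses small prime factors, absent at primes (Maynard2019TwinPrime p.6); parity-sensitive.
sources: Literature.NumberTheory.Sieve.MoebiusShiftedPrimesConjecture, Lichtman2020, LichtmanTeravainen2022, MurtyVatwani2017, Vatwani2016, Harman2007
[crux] (card Crux 2, Λ-weighted as 0613 per audit) For every h ≥ 1: Σ_{m ≤ (log x)^3} log m · |Σ_{d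
≤ x/m} μ(d)Λ(dm+h)| = o(x) — the Möbius function of the cofactor d of n = dm does not correlate with
primality of dm + h, ℓ¹-averaged over POLYLOGARITHMIC dilations m with the log m weight of the
opening (m = 1 has weight 0). Trivial mass ≍ x(3 log log x)²/2, so the demand is a uniform saving
just beyond (log log x)² — the (log x)^3-dilated instance of the dilation family whose x^ε-instance
is MobiusShiftedPrimes' M_avg (stmt-Parity-0613) and whose m = O(1) core is
Literature.NumberTheory.Sieve.MoebiusShiftedPrimesConjecture with Λ-weights. [difficulty:
open-problem] -/
@[route_item "route-Parity-PoissonVarianceAtom"]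
def PolylogAtom : Prop :=
  ∀ h : ℕ, 1 ≤ h → (fun x : ℝ => ∑ m ∈ Finset.Icc 1 ⌊Real.log x ^ 3⌋₊, Real.log m * |∑ d ∈ Finset.Icc 1 ⌊x / m⌋₊, (ArithmeticFunction.moebius d : ℝ) * ArithmeticFunction.vonMangoldt (d * m + h)|) =o[Filter.atTop] fun x : ℝ => x

/-- item stmt-Parity-7903 · crux · rank 4 · closed · moot by None · by planner
why it might fail: The large sieve bounds only the sum over ALL residues; for one class the off-diagonal is prime pairs over the 2-slope family (dk+h,dk'+h), k,k'≤x/D, of size (x/D)²<x; dispersion (BFI, Maynard) gives first moments/factorable weights, not L²; at D≈√x(log x)^{O(1)} even GRH is (log x)^4 short.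
sources: BombieriFriedlanderIwaniecActa1986, BombieriFriedlanderIwaniec1987, BombieriFriedlanderIwaniec1989, Maynard2020LargeModuliI, Hooley1975BDH1, Montgomery1971
[crux] (card Crux 1, power scales) For every h ≥ 1 and ε, A, B > 0, all large x, all lengths t_d ∈
[1, x] and all √x/(log x)^B ≤ D ≤ x^{1−ε}: Σ_{D<d≤2D, d squarefree, (d,h)=1} (ψ(t_d; d, h) −
t_d/φ(d))² ≤ x²/(D (log x)^A) — a log-power saving over the trivial x²(log x)²/D in mean square over
moduli for ONE residue class beyond √x: 'Barban–Davenport–Halberstam for a fixed residue', the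
L²-shadow of Elliott–Halberstam (which implies it) with Poisson room x^{ε}/polylog to spare. The
Assembly uses A = 5 (≤ 2 log x dyadic blocks, each ≤ 3x(log x)^{1−A/2} after Cauchy–Schwarz) and B
from Bombieri–Vinogradov at saving (log x)^{−2}. [difficulty: open-problem] -/
@[route_item "route-Parity-PoissonVarianceAtom"]
def FixedResidueVarianceLog : Prop :=
  ∀ h : ℕ, 1 ≤ h → ∀ ε : ℝ, 0 < ε → ∀ A : ℝ, 0 < A → ∀ B : ℝ, 0 < B → ∀ᶠ x : ℝ in Filter.atTop, ∀ t : ℕ → ℝ, (∀ d, t d ∈ Set.Icc 1 x) → ∀ D : ℝ, x ^ (1 / 2 : ℝ) / Real.log x ^ B ≤ D → D ≤ x ^ (1 - ε) → ∑ d ∈ (Finset.Ioc ⌊D⌋₊ ⌊2 * D⌋₊).filter (fun d => Squarefree d ∧ Nat.Coprime d h), (Literature.NumberTheory.Sieve.LevelOfDistribution.chebyshevPsiMod d (h : ZMod d) (t d) - t d / Nat.totient d) ^ 2 ≤ x ^ 2 / (D * Real.log x ^ A)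

/-- item stmt-Parity-0613 · support · rank 9 · closed · moot by None · by planner
sources: Harman2007, MurtyVatwani2017, Vatwani2016, Lichtman2020
(M_avg,h): for every h ≥ 1 there is ε > 0 with ∑_{m ≤ x^ε} log m · |∑_{d ≤ x/m} μ(d) Λ(dm + h)| =
o(x). This is exactly the residual of Bombieri's level-1 asymptotic sieve for a_n = Λ(n+h) (trivial
bound ≍ ε² x (log x)²/2), so it is the minimal parity-breaking input at level 1. Open. -/
@[route_item "route-Parity-PoissonVarianceAtom"]
def MobiusDilatedShiftedPrimesAvg : Prop :=
  ∀ h : ℕ, 1 ≤ h → ∃ ε : ℝ, 0 < ε ∧ (fun x : ℝ => ∑ m ∈ Finset.Icc 1 ⌊x ^ ε⌋₊, Real.log m * |∑ d ∈ Finset.Icc 1 ⌊x / m⌋₊, (ArithmeticFunction.moebius d : ℝ) * ArithmeticFunction.vonMangoldt (d * m + h)|) =o[Filter.atTop] fun x : ℝ => x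

/-- item stmt-Parity-7904 · support · rank 9 · closed · moot by None · by planner
sources: Mathlib ArithmeticFunction.moebius_mul_log_eq_vonMangoldt, BombieriAsymptoticSieve1976
[support] The exact one-sided opening (provable now from Mathlib's
ArithmeticFunction.moebius_mul_log_eq_vonMangoldt and the reindexing n = dm ↔ (m, d ≤ x/m)): for all
h, x ∈ ℕ, Σ_{n≤x} Λ(n)Λ(n+h) = Σ_{m≤x} log m · Σ_{d≤x/m} μ(d)Λ(dm+h). [difficulty: provable-now] -/
@[route_item "route-Parity-PoissonVarianceAtom"]
def OpeningIdentity : Prop :=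
  ∀ h x : ℕ, ∑ n ∈ Finset.Icc 1 x, ArithmeticFunction.vonMangoldt n * ArithmeticFunction.vonMangoldt (n + h) = ∑ m ∈ Finset.Icc 1 x, Real.log m * ∑ d ∈ Finset.Icc 1 (x / m), (ArithmeticFunction.moebius d : ℝ) * ArithmeticFunction.vonMangoldt (d * m + h)

/-- item stmt-Parity-7905 · support · rank 9 · closed · moot by None · by planner
sources: BombieriAsymptoticSieve1976, Literature.NumberTheory.Sieve.singularSeries_pair, Literature.NumberTheory.LFunctions.SiegelWalfiszMoebius_holds, IwaniecKowalski2004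
[support] Main term of the opened sum, uniformly in the dilation cut: for every h ≥ 1 and η > 0, for
all large x and all integers 1 ≤ M ≤ √x, |Σ_{d ≤ x/M, (d,h)=1} μ(d)(d/φ(d))·[(x/d)log(x/d) − x/d −
(M log M − M)] − 𝔖({0,h})·x| ≤ ηx. Here (d/φ(d))[G(x/d) − G(M)], G(u) = u log u − u, is the expected
value (density 1/φ(d)) of Σ_{M<m≤x/d} log m Λ(dm+h). Proof (provable, PNT-rate inputs): Σ'_{d≤y}
μ(d)/φ(d) ≪ e^{−c√log y} (times log x → 0 for y ≥ √x), −Σ'_{d≤y} μ(d) log d/φ(d) → 𝔖({0,h})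
(Bombieri (1.13)–(1.14); for odd h both sides vanish), Σ'_{d≤y} μ(d) d/φ(d) ≪ y e^{−c√log y} (so the
G(M) part is ≪ x log x·e^{−c√(log x/2)}); Siegel–Walfisz for μ is in tree. [difficulty: M] -/
@[route_item "route-Parity-PoissonVarianceAtom"]
def MainTermEvaluation : Prop :=
  ∀ h : ℕ, 1 ≤ h → ∀ η : ℝ, 0 < η → ∀ᶠ x : ℝ in Filter.atTop, ∀ M : ℕ, 1 ≤ M → (M : ℝ) ≤ Real.sqrt x → |(∑ d ∈ (Finset.Icc 1 ⌊x / M⌋₊).filter (fun d => Nat.Coprime d h), (ArithmeticFunction.moebius d : ℝ) * ((d : ℝ) / Nat.totient d) * ((x / d) * Real.log (x / d) - x / d - ((M : ℝ) * Real.log M - M))) - Literature.NumberTheory.Sieve.singularSeries ({0, (h : ℤ)} : Finset ℤ) * x| ≤ η * x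

/-- item stmt-Parity-7906 · support · rank 9 · closed · moot by None · by planner
sources: MurtyVatwani2017, Vatwani2019, BombieriAsymptoticSieve1976, Literature.NumberTheory.Sieve.bombieri_vinogradov
[support] The power-co-level exit = the EH-free form of route MobiusShiftedPrimes: OpeningIdentity →
MainTermEvaluation → FixedResidueVarianceLog → MobiusDilatedShiftedPrimesAvg → PairsHL. Proof = the
Assembly's bookkeeping with M = ⌊x^ε⌋, ε from 0613 (WLOG ε ≤ 1/2 since the ℓ¹ atom is monotone in
ε): Bombieri–Vinogradov (tree: Literature.NumberTheory.Sieve.bombieri_vinogradov, proved) for d ≤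
√x/(log x)^B; Cauchy–Schwarz per dyadic block with FixedResidueVarianceLog (A = 5, ε/2) for √x/(log
x)^B < d ≤ x^{1−ε}: total ≤ 6x(log x)^{2−A/2} = o(x); moduli with (d,h) > 1 contribute ≤
(x/M)·O_h(log² x) = o(x); the atom covers m ≤ x^ε. [difficulty: L] -/
@[route_item "route-Parity-PoissonVarianceAtom"]
def PowerColevelExit : Prop :=
  OpeningIdentity → MainTermEvaluation → FixedResidueVarianceLog → MobiusDilatedShiftedPrimesAvg → PairsHL

/-- item stmt-Parity-7907 · assembly · rank 1 · closed · moot by None · by planner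
sources: BombieriAsymptoticSieve1976, Literature.NumberTheory.Sieve.bombieri_vinogradov, MurtyVatwani2017, Hooley1975BDH1
[assembly] OpeningIdentity → MainTermEvaluation → FixedResidueVarianceLog → PoissonVarianceTop →
PolylogAtom → PairsHL (the two supports are provable now; the three cruxes are X₁, X₂, X₃ of the
Thesis). -/
@[route_item "route-Parity-PoissonVarianceAtom"]
def Assembly : Prop :=
  OpeningIdentity → MainTermEvaluation → FixedResidueVarianceLog → PoissonVarianceTop → PolylogAtom → PairsHL

end Summit.Parity.GeneralizedHardyLittlewood.Theses.PoissonVarianceAtom
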